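/-
Copyright (c) 2026 the pub-hodgecm-mathlib formalisation cell (harness21).  Prover seat hodgecm-mathlib-LH5-p02 (g3): line LH4 (dyadic pay-down of `stub_N6nsDyadic`),
WILD road, plumbing brick (J2) «Fix(σ_w) = algebraMap(L⁺_v)» + «N_{L_w/L⁺_v} x = x · σ_w x» (LH4-plan (g3) DEALER WORD #27, after the (b1) NORM-INDEX-TWO census); 2026-09-02.
-/
import Literature.NumberTheory.GaloisRepresentations.SemiLocalShapiro   -- ★ `SemiLocal.decompAlgEquiv` / `decompMulEquiv` / `isGalois_place` / `natCard_algEquiv_place`, `SemiLocal.Place`, `SemiLocal.algebraPlace`; brings `galAdicCompletionMap`, `adicCompletionOfLiesOver`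
import Mathlib.RingTheory.Norm.Transitivity                              -- `Algebra.norm_eq_prod_automorphisms`
import Mathlib.NumberTheory.NumberField.CMField                          -- `NumberField.IsCMField.complexConj`, `IsQuadraticExtension (maximalRealSubfield L) L`
import HarnessLib

/-!
# The fixed field and the norm of the local quadratic extension `E_w ∕ F_v` at a non-split place, in `galAdicCompletionMap` currency
# (Cassels–Fröhlich Ch. VII (Tate) §1.1; Neukirch ANT II (9.6); for CM fields `L ∕ L⁺`)

Topic `NumberTheory/LocalFields`; namespace `Literature.NumberTheory.LocalFields`.  THEOREMS ONLY (no definition, no instance, no notation, no named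
fact, no `sorry`).  Cell `pub/hodgecm-mathlib` (D-0151), crux H413 = `stmt-HodgeConjecture-24833`, line LH4 (dyadic∕wild pay-down road), plumbing brick (J2) of the
(b1) «NORM INDEX TWO» census (`F0/P3c/LH5/LH5-p02/g3/NORM-INDEX-TWO-CENSUS.md`): the «un-typed transport `Fix(σ_w) = algebraMap(L⁺_v)`» that the σ_w-currency
files (`LocalFields/QuadraticNormIndexFiniteCM`, `Rogawski1990/UnipotentOrbitalIntegralLevelPiecesRamifiedCM`, …) kept re-deriving.
HONEST LABEL: HC_CM is proved only modulo the 7 printed citations (2 remaining: hLiu418 24832, h413 24833) until rung 0 closes; this file is unconditional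
algebra of completions, count-neutral.

SETTING.  `E ∕ F` a finite Galois extension of number fields (`F E : Type`, as in the ★ semi-local files), `v` a finite place of `F`,
`w : SemiLocal.Place F E v` a place of `E` above `v` (the subtype `{w // w.under (𝓞 F) = v}` — the SAME subtype as `UnitaryGroup.PlacesOver E v`; a holder of
`w : UnitaryGroup.PlacesOver L v` passes `⟨w.1, w.2⟩`), `F_v = v.adicCompletion F`, `E_w = (w : HeightOneSpectrum (𝓞 E)).adicCompletion E` with the ★ algebra structure
`SemiLocal.algebraPlace w` (`algebraMap F_v E_w = adicCompletionOfLiesOver F E v w`, ★ `SemiLocal.algebraMap_place_eq`).  For `g ∈ Gal(E∕F)` with `g • w = w` the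
continuous extension `g_w = galAdicCompletionMap g _ : E_w →+* E_w` is an `F_v`-algebra automorphism (★ `SemiLocal.decompAlgEquiv`, definitionally `galAdicCompletionMap`,
★ `decompAlgEquiv_apply`), and `Stab(w) ≃* Gal(E_w∕F_v)` (★ `SemiLocal.decompMulEquiv`), `E_w∕F_v` Galois (★ `SemiLocal.isGalois_place`).

* §1 (any finite Galois `E∕F`): `galAdicCompletionMap_algebraMap_place` (`g_w` fixes `F_v`), `valued_algebraMap_place` (`|ι y|_w = |y|_v ^ e(w|v)`),
  **`mem_range_algebraMap_place_iff_forall`** — `x ∈ F_v ↔ g_w x = x` for every `g ∈ Gal(E∕F)` fixing `w` (Galois correspondence for `E_w∕F_v` read through `decompMulEquiv`).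
* §2 (`#Gal(E∕F) = 2`, `c ≠ 1`, `c • w = w` — a NON-SPLIT place of a quadratic extension; unramified, tame or wild alike): private `eq_one_or_eq_of_card_eq_two` (the group is `{1, c}`),
  `stabilizer_place_eq_top_of_card_eq_two`, `finrank_place_eq_two`, **`mem_range_algebraMap_place_iff_of_card_eq_two`** — `x ∈ F_v ↔ c_w x = x`,
  `exists_algebraMap_place_eq_of_card_eq_two` (the `∃`-form), **`algebraMap_norm_place_eq_mul_of_card_eq_two`** — `N_{E_w∕F_v}(x) = x · c_w x` (read in `E_w`),
  `mul_galAdicCompletionMap_mem_range_algebraMap` (`x · c_w x ∈ F_v`).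
* §3 (CM fields: `L` with `[IsCMField L]`, `L⁺ = maximalRealSubfield L`, `c = NumberField.IsCMField.complexConj L`, `w : SemiLocal.Place L⁺ L v` with `complexConj L • w = w`):
  private `IsCMField.natCard_algEquiv_eq_two` (`#Gal(L∕L⁺) = 2`, Mathlib), **`IsCMField.mem_range_algebraMap_place_iff`**, `IsCMField.exists_algebraMap_place_eq`, **`IsCMField.algebraMap_norm_place_eq_mul`**,
  `IsCMField.mul_galAdicCompletionMap_mem_range_algebraMap` — the consumers' spelling `galAdicCompletionMap (IsCMField.complexConj L) hw`.
USAGE from `UnitaryGroup.PlacesOver` currency: `UnitaryGroup.PlacesOver L v` (an `abbrev`) and `SemiLocal.Place L⁺ L v` (a `def`) are the same subtype `{w // w.under (𝓞 L⁺) = v}`;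
a holder of `w : UnitaryGroup.PlacesOver L v`, `hw : complexConj L • w.1 = w.1`, `x : w.1.adicCompletion L` passes `w` ITSELF for the `(w : SemiLocal.Place L⁺ L v)` argument
(definitional unfolding; do not rebuild `⟨w.1, w.2⟩`, whose inferred type is the bare subtype and misses the ★ place-algebra instance), e.g.
`IsCMField.exists_algebraMap_place_eq L w hw hx : ∃ y, algebraMap (v.adicCompletion L⁺) ((SemiLocal.Place.val w).adicCompletion L) y = x` — tested in the
report-first byte-set's scratch twin (`example` over the bare subtype, GREEN).

## References
* J. W. S. Cassels, A. Fröhlich (eds.), *Algebraic Number Theory* (1967), Ch. VII (J. Tate) §1.1 («`σ_w` is a `K_v`-isomorphism», «`G_w` is the Galois group of `L_w∕K_v`»).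
  [CasselsFrohlichANT1967]
* J. Neukirch, *Algebraic Number Theory*, Grundlehren 322 (1999), Ch. II (9.6) (`G_w ≅ G(L_w|K_v)`), Ch. II (8.2)–(8.5). [NeukirchANT1999]

## Tree search
`lean search 'mem_range_algebraMap_place|algebraMap_norm_place|galAdicCompletionMap_algebraMap_place'`: no prior declaration.  Inputs: ★ `SemiLocal.decompAlgEquiv(_apply)`,
`SemiLocal.decompMulEquiv(_apply)`, `SemiLocal.decompHom_injective`, `SemiLocal.isGalois_place`, `SemiLocal.natCard_algEquiv_place`, `SemiLocal.finiteDimensional_place`,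
`SemiLocal.Place.coe_smul`, `galAdicCompletionMap_adicCompletionOfLiesOver`, `galAdicCompletionMap_one`, `valued_adicCompletionOfLiesOver`; Mathlib
`IsGalois.mem_range_algebraMap_iff_fixed`, `Algebra.norm_eq_prod_automorphisms`, `Nat.card_eq_two_iff'`, `IsGalois.card_aut_eq_finrank`, `IsQuadraticExtension.finrank_eq_two`,
`NumberField.IsCMField.complexConj_ne_one`.
-/

namespace Literature.NumberTheory.LocalFields

open NumberField IsDedekindDomain
open Literature.NumberTheory.Automorphic Literature.NumberTheory.GaloisRepresentations
open Literature.NumberTheory.GaloisRepresentations.SemiLocal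

variable {F : Type} [Field F] [NumberField F] {E : Type} [Field E] [NumberField E] [Algebra F E]
variable {v : HeightOneSpectrum (𝓞 F)}

/-! ## §1 Any finite Galois `E ∕ F`: `g_w` fixes `F_v`; the fixed field of the `g_w` is `F_v` -/

/-- **`g_w` fixes `F_v`**: `galAdicCompletionMap g _ (ι y) = ι y` for the structure map `ι = algebraMap F_v E_w` (Tate: «`σ_w` is a `K_v`-isomorphism»).
[cite: CasselsFrohlichANT1967, Ch. VII §1.1] -/
theorem galAdicCompletionMap_algebraMap_place (w : Place F E v) (g : E ≃ₐ[F] E) (hg : g • (w : HeightOneSpectrum (𝓞 E)) = w)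
    (y : v.adicCompletion F) :
    galAdicCompletionMap (L := E) g hg (algebraMap (v.adicCompletion F) ((w : HeightOneSpectrum (𝓞 E)).adicCompletion E) y) =
      algebraMap (v.adicCompletion F) ((w : HeightOneSpectrum (𝓞 E)).adicCompletion E) y :=
  galAdicCompletionMap_adicCompletionOfLiesOver F g v hg y

/-- **Valuations under `F_v → E_w`**: `|ι y|_w = |y|_v ^ e(w|v)` (★ `valued_adicCompletionOfLiesOver`, in `algebraMap` spelling). [cite: CasselsFrohlichANT1967, Ch. II §10] -/
theorem valued_algebraMap_place (w : Place F E v) (y : v.adicCompletion F) :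
    Valued.v (algebraMap (v.adicCompletion F) ((w : HeightOneSpectrum (𝓞 E)).adicCompletion E) y) =
      Valued.v y ^ v.asIdeal.ramificationIdx' (w : HeightOneSpectrum (𝓞 E)).asIdeal :=
  valued_adicCompletionOfLiesOver F E v (w : HeightOneSpectrum (𝓞 E)) y

/-- **The fixed field of the decomposition group acting on `E_w` is `F_v`**: for `E ∕ F` Galois, `x ∈ E_w` lies in (the image of) `F_v` iff `g_w x = x` for every
`g ∈ Gal(E∕F)` with `g • w = w` (Galois theory for `E_w ∕ F_v`, whose group is `Stab(w)` through ★ `decompMulEquiv`).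
[cite: CasselsFrohlichANT1967, Ch. VII §1.1] [cite: NeukirchANT1999, Ch. II (9.6)] -/
theorem mem_range_algebraMap_place_iff_forall [IsGalois F E] (w : Place F E v) (x : (w : HeightOneSpectrum (𝓞 E)).adicCompletion E) :
    x ∈ Set.range (algebraMap (v.adicCompletion F) ((w : HeightOneSpectrum (𝓞 E)).adicCompletion E)) ↔
      ∀ (g : E ≃ₐ[F] E) (hg : g • (w : HeightOneSpectrum (𝓞 E)) = w), galAdicCompletionMap (L := E) g hg x = x := by
  haveI := finiteDimensional_place (K := F) w
  haveI := isGalois_place (F := F) w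
  rw [IsGalois.mem_range_algebraMap_iff_fixed]
  constructor
  · intro h g hg
    have hmem : g ∈ MulAction.stabilizer (E ≃ₐ[F] E) w := MulAction.mem_stabilizer_iff.mpr (Place.ext hg)
    exact h (decompAlgEquiv w ⟨g, hmem⟩)
  · intro h f
    obtain ⟨g, rfl⟩ := (decompMulEquiv w).surjective f
    exact h (g : E ≃ₐ[F] E) (coe_stabilizer_smul w g)

/-! ## §2 Quadratic `E ∕ F` at a non-split place: `Gal(E∕F) = {1, c}`, `c • w = w` -/

/-- In a group with exactly two elements, every element is `1` or the given non-trivial one. [folklore] -/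
private theorem eq_one_or_eq_of_card_eq_two {G : Type*} [One G] (hG : Nat.card G = 2) {c : G} (hc : c ≠ 1) (g : G) : g = 1 ∨ g = c := by
  obtain ⟨y, -, huniq⟩ := (Nat.card_eq_two_iff' (1 : G)).mp hG
  by_cases hg : g = 1
  · exact Or.inl hg
  · exact Or.inr ((huniq g hg).trans (huniq c hc).symm)

section Quadratic

variable [IsGalois F E] (hG : Nat.card (E ≃ₐ[F] E) = 2) (w : Place F E v) {c : E ≃ₐ[F] E} (hc : c ≠ 1)
  (hw : c • (w : HeightOneSpectrum (𝓞 E)) = w)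

include hG hc hw

omit [IsGalois F E] in
/-- At a place fixed by the non-trivial automorphism of a quadratic extension, the decomposition group is everything (the place is NON-SPLIT).
[cite: CasselsFrohlichANT1967, Ch. VII §1.1] -/
theorem stabilizer_place_eq_top_of_card_eq_two : MulAction.stabilizer (E ≃ₐ[F] E) w = ⊤ := by
  refine eq_top_iff.mpr fun g _ => MulAction.mem_stabilizer_iff.mpr ?_
  rcases eq_one_or_eq_of_card_eq_two hG hc g with rfl | rfl
  · exact one_smul _ w
  · exact Place.ext hw

/-- **`[E_w : F_v] = 2`** at a non-split place of a quadratic extension (`= #Stab(w) = #Gal(E∕F)`). [cite: CasselsFrohlichANT1967, Ch. VII §1.1–1.2] -/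
theorem finrank_place_eq_two : Module.finrank (v.adicCompletion F) ((w : HeightOneSpectrum (𝓞 E)).adicCompletion E) = 2 := by
  rw [finrank_place_eq_card_stabilizer w, stabilizer_place_eq_top_of_card_eq_two hG w hc hw, Subgroup.card_top, hG]

/-- **`#Gal(E_w ∕ F_v) = 2`** at a non-split place of a quadratic extension. [cite: CasselsFrohlichANT1967, Ch. VII §1.1] -/
theorem natCard_algEquiv_place_eq_two :
    Nat.card (((w : HeightOneSpectrum (𝓞 E)).adicCompletion E) ≃ₐ[v.adicCompletion F] ((w : HeightOneSpectrum (𝓞 E)).adicCompletion E)) = 2 := by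
  rw [natCard_algEquiv_place w, stabilizer_place_eq_top_of_card_eq_two hG w hc hw, Subgroup.card_top, hG]

/-- **`Fix(c_w) = F_v`**: at a non-split place `w` of a quadratic extension with non-trivial automorphism `c`, an element of `E_w` lies in (the image of) `F_v` iff it is fixed by
`c_w = galAdicCompletionMap c _`. [cite: CasselsFrohlichANT1967, Ch. VII §1.1] [cite: NeukirchANT1999, Ch. II (9.6)] -/
theorem mem_range_algebraMap_place_iff_of_card_eq_two (x : (w : HeightOneSpectrum (𝓞 E)).adicCompletion E) :
    x ∈ Set.range (algebraMap (v.adicCompletion F) ((w : HeightOneSpectrum (𝓞 E)).adicCompletion E)) ↔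
      galAdicCompletionMap (L := E) c hw x = x := by
  rw [mem_range_algebraMap_place_iff_forall w x]
  constructor
  · exact fun h => h c hw
  · intro h g hg
    rcases eq_one_or_eq_of_card_eq_two hG hc g with rfl | rfl
    · exact galAdicCompletionMap_one E hg x
    · exact h

/-- The `∃`-form: **a `c_w`-fixed element of `E_w` comes from `F_v`**. [cite: CasselsFrohlichANT1967, Ch. VII §1.1] -/
theorem exists_algebraMap_place_eq_of_card_eq_two {x : (w : HeightOneSpectrum (𝓞 E)).adicCompletion E}
    (hx : galAdicCompletionMap (L := E) c hw x = x) :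
    ∃ y : v.adicCompletion F, algebraMap (v.adicCompletion F) ((w : HeightOneSpectrum (𝓞 E)).adicCompletion E) y = x :=
  (mem_range_algebraMap_place_iff_of_card_eq_two hG w hc hw x).mpr hx

/-- **`N_{E_w ∕ F_v}(x) = x · c_w x`** (read in `E_w`) at a non-split place of a quadratic extension: `Gal(E_w∕F_v) = {1, c_w}` and Mathlib's
`Algebra.norm_eq_prod_automorphisms`. [cite: CasselsFrohlichANT1967, Ch. VII §1.1] [cite: NeukirchANT1999, Ch. II (9.6)] -/
theorem algebraMap_norm_place_eq_mul_of_card_eq_two (x : (w : HeightOneSpectrum (𝓞 E)).adicCompletion E) :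
    algebraMap (v.adicCompletion F) ((w : HeightOneSpectrum (𝓞 E)).adicCompletion E) (Algebra.norm (v.adicCompletion F) x) =
      x * galAdicCompletionMap (L := E) c hw x := by
  classical
  haveI := finiteDimensional_place (K := F) w
  haveI := isGalois_place (F := F) w
  have hcmem : c ∈ MulAction.stabilizer (E ≃ₐ[F] E) w := MulAction.mem_stabilizer_iff.mpr (Place.ext hw)
  set σ := decompAlgEquiv w ⟨c, hcmem⟩ with hσdef
  have hσ1 : σ ≠ 1 := by
    intro h1
    have hinj := decompHom_injective w (a₁ := ⟨c, hcmem⟩) (a₂ := 1) (by rw [decompHom_apply, decompHom_apply, ← hσdef, h1, ← decompHom_apply, map_one])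
    exact hc (congrArg Subtype.val hinj)
  have hcard : Fintype.card (((w : HeightOneSpectrum (𝓞 E)).adicCompletion E) ≃ₐ[v.adicCompletion F]
      ((w : HeightOneSpectrum (𝓞 E)).adicCompletion E)) = 2 := by
    rw [← Nat.card_eq_fintype_card]; exact natCard_algEquiv_place_eq_two hG w hc hw
  have huniv : ({1, σ} : Finset (((w : HeightOneSpectrum (𝓞 E)).adicCompletion E) ≃ₐ[v.adicCompletion F]
      ((w : HeightOneSpectrum (𝓞 E)).adicCompletion E))) = Finset.univ :=
    Finset.eq_univ_of_card _ (by rw [Finset.card_pair (Ne.symm hσ1), hcard])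
  rw [Algebra.norm_eq_prod_automorphisms, ← huniv, Finset.prod_pair (Ne.symm hσ1), AlgEquiv.one_apply, hσdef, decompAlgEquiv_apply]

/-- **`x · c_w x ∈ F_v`**: the local norm of `x ∈ E_w` lies in the base field. [cite: CasselsFrohlichANT1967, Ch. VII §1.1] -/
theorem mul_galAdicCompletionMap_mem_range_algebraMap (x : (w : HeightOneSpectrum (𝓞 E)).adicCompletion E) :
    x * galAdicCompletionMap (L := E) c hw x ∈ Set.range (algebraMap (v.adicCompletion F) ((w : HeightOneSpectrum (𝓞 E)).adicCompletion E)) :=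
  ⟨Algebra.norm (v.adicCompletion F) x, algebraMap_norm_place_eq_mul_of_card_eq_two hG w hc hw x⟩

end Quadratic

/-! ## §3 CM fields `L ∕ L⁺`: the consumers' spelling `galAdicCompletionMap (IsCMField.complexConj L) hw` -/

section CM

variable (L : Type) [Field L] [NumberField L] [IsCMField L] {v : HeightOneSpectrum (𝓞 ↥(maximalRealSubfield L))}
  (w : Place ↥(maximalRealSubfield L) L v) (hw : IsCMField.complexConj L • (w : HeightOneSpectrum (𝓞 L)) = w)

/-- `#Gal(L ∕ L⁺) = 2` for a CM field `L` (Mathlib: `L ∕ L⁺` is a Galois quadratic extension). [folklore] -/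
private theorem IsCMField.natCard_algEquiv_eq_two : Nat.card (L ≃ₐ[↥(maximalRealSubfield L)] L) = 2 := by
  rw [IsGalois.card_aut_eq_finrank, Algebra.IsQuadraticExtension.finrank_eq_two]

include hw

/-- **`Fix(σ_w) = L⁺_v`** for a CM field: at a place `w` fixed by complex conjugation (i.e. NON-SPLIT in `L ∕ L⁺`; unramified, tame or wild alike), `x ∈ L_w` lies in (the image of)
`L⁺_v` iff `σ_w x = x`, `σ_w = galAdicCompletionMap (IsCMField.complexConj L) hw`. [cite: CasselsFrohlichANT1967, Ch. VII §1.1] [cite: NeukirchANT1999, Ch. II (9.6)] -/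
theorem IsCMField.mem_range_algebraMap_place_iff (x : (w : HeightOneSpectrum (𝓞 L)).adicCompletion L) :
    x ∈ Set.range (algebraMap (v.adicCompletion ↥(maximalRealSubfield L)) ((w : HeightOneSpectrum (𝓞 L)).adicCompletion L)) ↔
      galAdicCompletionMap (L := L) (IsCMField.complexConj L) hw x = x :=
  mem_range_algebraMap_place_iff_of_card_eq_two (IsCMField.natCard_algEquiv_eq_two L) w (IsCMField.complexConj_ne_one L) hw x

/-- The `∃`-form for CM fields: **a `σ_w`-fixed element of `L_w` comes from `L⁺_v`**. [cite: CasselsFrohlichANT1967, Ch. VII §1.1] -/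
theorem IsCMField.exists_algebraMap_place_eq {x : (w : HeightOneSpectrum (𝓞 L)).adicCompletion L}
    (hx : galAdicCompletionMap (L := L) (IsCMField.complexConj L) hw x = x) :
    ∃ y : v.adicCompletion ↥(maximalRealSubfield L), algebraMap (v.adicCompletion ↥(maximalRealSubfield L)) ((w : HeightOneSpectrum (𝓞 L)).adicCompletion L) y = x :=
  exists_algebraMap_place_eq_of_card_eq_two (IsCMField.natCard_algEquiv_eq_two L) w (IsCMField.complexConj_ne_one L) hw hx

/-- **`N_{L_w ∕ L⁺_v}(x) = x · σ_w x`** (read in `L_w`) for a CM field at a non-split place. [cite: CasselsFrohlichANT1967, Ch. VII §1.1] [cite: NeukirchANT1999, Ch. II (9.6)] -/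
theorem IsCMField.algebraMap_norm_place_eq_mul (x : (w : HeightOneSpectrum (𝓞 L)).adicCompletion L) :
    algebraMap (v.adicCompletion ↥(maximalRealSubfield L)) ((w : HeightOneSpectrum (𝓞 L)).adicCompletion L)
        (Algebra.norm (v.adicCompletion ↥(maximalRealSubfield L)) x) =
      x * galAdicCompletionMap (L := L) (IsCMField.complexConj L) hw x :=
  algebraMap_norm_place_eq_mul_of_card_eq_two (IsCMField.natCard_algEquiv_eq_two L) w (IsCMField.complexConj_ne_one L) hw x

/-- **`x · σ_w x ∈ L⁺_v`** for a CM field at a non-split place. [cite: CasselsFrohlichANT1967, Ch. VII §1.1] -/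
theorem IsCMField.mul_galAdicCompletionMap_mem_range_algebraMap (x : (w : HeightOneSpectrum (𝓞 L)).adicCompletion L) :
    x * galAdicCompletionMap (L := L) (IsCMField.complexConj L) hw x ∈
      Set.range (algebraMap (v.adicCompletion ↥(maximalRealSubfield L)) ((w : HeightOneSpectrum (𝓞 L)).adicCompletion L)) :=
  Literature.NumberTheory.LocalFields.mul_galAdicCompletionMap_mem_range_algebraMap
    (IsCMField.natCard_algEquiv_eq_two L) w (IsCMField.complexConj_ne_one L) hw x

end CM

end Literature.NumberTheory.LocalFields
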